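import Mathlib
import Literature.Analysis.FunctionSpaces.TorusEnstrophyOrthogonality

/-!
# Phantom floor law — support I: strain forms and a Korn-type bound

Support for `Theorems/TaylorCertificatesPhantomFloorLaw.lean` (item stmt-AnomalousDissipation-14033, route
`AnomalousDissipation/TaylorCertificates`, decl `PhantomFloorLaw`). Pointwise linear algebra of the quadratic form
`y ↦ ⟪L y, y⟫` of an operator on `ℝ³` under the bound `|⟪L η, η⟫| ≤ s` on unit vectors (scaling, polarisation,
entrywise bounds of the symmetrised matrix); the Korn-type bound
`‖∇W‖₂² ≤ 162 s²` for a smooth divergence-free `W` on `T³` whose strain form is bounded by `s`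
(`∫ ∑ᵢⱼ ∂ⱼWᵢ ∂ᵢWⱼ = ∫ (div W)… = 0` by two integrations by parts); and the strain supremum of a smooth
divergence-free field together with a most compressive direction carrying strain `≤ −s/2` (compactness of
`T³ × S²`; the gradient is trace-free, read along an orthonormal basis through the maximiser).
-/

noncomputable section

-- `Summit.<Summit>.<Sub>` repeats `AnomalousDissipation` by the tree's layout (D-0017), as in the sibling files.
set_option linter.dupNamespace false

open MeasureTheory Filter Topology UnitAddTorus
open scoped InnerProductSpace ENNReal

namespace Summit.AnomalousDissipation.AnomalousDissipation.Theorems.PhantomFloor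

open Literature.Analysis.FunctionSpaces

/-- Scaling: a bound of the quadratic form `⟪L η, η⟫` on unit vectors gives `|⟪L y, y⟫| ≤ s‖y‖²`. -/
theorem quad_bound_of_unit (L : (EuclideanSpace ℝ (Fin 3)) →L[ℝ] (EuclideanSpace ℝ (Fin 3))) {s : ℝ}
    (h : ∀ η : (EuclideanSpace ℝ (Fin 3)), ‖η‖ = 1 → |⟪η, L η⟫_ℝ| ≤ s) (y : (EuclideanSpace ℝ (Fin 3))) : |⟪L y, y⟫_ℝ| ≤ s * ‖y‖ ^ 2 := by
  by_cases hy : y = 0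
  · simp [hy]
  · have hn : 0 < ‖y‖ := norm_pos_iff.2 hy
    have hη : ‖(‖y‖⁻¹ : ℝ) • y‖ = 1 := by
      rw [norm_smul, norm_inv, norm_norm, inv_mul_cancel₀ hn.ne']
    have h1 := h _ hη
    rw [map_smul, inner_smul_left, inner_smul_right, real_inner_comm] at h1
    simp only [conj_trivial] at h1
    rw [← mul_assoc, abs_mul, show |‖y‖⁻¹ * ‖y‖⁻¹| = (‖y‖ ^ 2)⁻¹ by
      rw [abs_of_pos (by positivity)]; field_simp] at h1
    rwa [inv_mul_le_iff₀ (by positivity), mul_comm] at h1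

/-- Polarisation bound for the symmetrised bilinear form: `⟪L v, h⟫ + ⟪L h, v⟫ ≤ s (τ‖v‖² + τ⁻¹‖h‖²)`. -/
theorem cross_le (L : (EuclideanSpace ℝ (Fin 3)) →L[ℝ] (EuclideanSpace ℝ (Fin 3))) {s : ℝ} (hq : ∀ y : (EuclideanSpace ℝ (Fin 3)), |⟪L y, y⟫_ℝ| ≤ s * ‖y‖ ^ 2)
    (v h : (EuclideanSpace ℝ (Fin 3))) {τ : ℝ} (hτ : 0 < τ) :
    ⟪L v, h⟫_ℝ + ⟪L h, v⟫_ℝ ≤ s * (τ * ‖v‖ ^ 2 + τ⁻¹ * ‖h‖ ^ 2) := by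
  set a : ℝ := Real.sqrt τ with ha
  have ha0 : 0 < a := Real.sqrt_pos.2 hτ
  have ha2 : a ^ 2 = τ := Real.sq_sqrt hτ.le
  set p : (EuclideanSpace ℝ (Fin 3)) := a • v + a⁻¹ • h with hp
  set m : (EuclideanSpace ℝ (Fin 3)) := a • v - a⁻¹ • h with hm
  have key : ⟪L p, p⟫_ℝ - ⟪L m, m⟫_ℝ = 2 * (⟪L v, h⟫_ℝ + ⟪L h, v⟫_ℝ) := by
    simp only [hp, hm, map_add, map_sub, map_smul, inner_add_left, inner_add_right, inner_sub_left,
      inner_sub_right, inner_smul_left, inner_smul_right, conj_trivial]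
    field_simp
    ring
  have h1 := hq p
  have h2 := hq m
  have hpar : ‖p‖ ^ 2 + ‖m‖ ^ 2 = 2 * (τ * ‖v‖ ^ 2 + τ⁻¹ * ‖h‖ ^ 2) := by
    have := parallelogram_law_with_norm ℝ (a • v) (a⁻¹ • h)
    simp only [hp, hm]
    rw [norm_smul, norm_smul, Real.norm_of_nonneg ha0.le, Real.norm_of_nonneg (inv_nonneg.2 ha0.le)] at this
    have e1 : (a * ‖v‖) * (a * ‖v‖) = τ * ‖v‖ ^ 2 := by rw [← ha2]; ring
    have e2 : (a⁻¹ * ‖h‖) * (a⁻¹ * ‖h‖) = τ⁻¹ * ‖h‖ ^ 2 := by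
      rw [← ha2]; field_simp
    nlinarith [this, e1, e2]
  have h3 : s * ‖p‖ ^ 2 + s * ‖m‖ ^ 2 = 2 * s * (τ * ‖v‖ ^ 2 + τ⁻¹ * ‖h‖ ^ 2) := by
    rw [← mul_add, hpar]; ring
  have := abs_le.1 h1
  have := abs_le.1 h2
  linarith

/-- The defect of the quadratic form between `a` and `v`: with `h = a - v`,
`⟪L a, a⟫ − ⟪L v, v⟫ ≤ s (τ‖v‖² + τ⁻¹‖a − v‖² + ‖a − v‖²)`. -/
theorem quad_defect_le (L : (EuclideanSpace ℝ (Fin 3)) →L[ℝ] (EuclideanSpace ℝ (Fin 3))) {s : ℝ} (hq : ∀ y : (EuclideanSpace ℝ (Fin 3)), |⟪L y, y⟫_ℝ| ≤ s * ‖y‖ ^ 2)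
    (a v : (EuclideanSpace ℝ (Fin 3))) {τ : ℝ} (hτ : 0 < τ) :
    ⟪L a, a⟫_ℝ - ⟪L v, v⟫_ℝ ≤ s * (τ * ‖v‖ ^ 2 + τ⁻¹ * ‖a - v‖ ^ 2 + ‖a - v‖ ^ 2) := by
  have hsplit : ⟪L a, a⟫_ℝ - ⟪L v, v⟫_ℝ =
      (⟪L v, a - v⟫_ℝ + ⟪L (a - v), v⟫_ℝ) + ⟪L (a - v), a - v⟫_ℝ := by
    simp only [map_sub, inner_sub_left, inner_sub_right]
    ring
  rw [hsplit]
  have h1 := cross_le L hq v (a - v) hτ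
  have h2 := (abs_le.1 (hq (a - v))).2
  nlinarith

/-- Entrywise bound on the symmetrised matrix: `|L_{ij} + L_{ji}| ≤ 6 s`. -/
theorem entry_symm_le (L : (EuclideanSpace ℝ (Fin 3)) →L[ℝ] (EuclideanSpace ℝ (Fin 3))) {s : ℝ} (hq : ∀ y : (EuclideanSpace ℝ (Fin 3)), |⟪L y, y⟫_ℝ| ≤ s * ‖y‖ ^ 2)
    (i j : Fin 3) :
    |L (EuclideanSpace.single j 1) i + L (EuclideanSpace.single i 1) j| ≤ 6 * s := by
  set ei : (EuclideanSpace ℝ (Fin 3)) := EuclideanSpace.single i 1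
  set ej : (EuclideanSpace ℝ (Fin 3)) := EuclideanSpace.single j 1
  have hei : ‖ei‖ = 1 := by simp [ei]
  have hej : ‖ej‖ = 1 := by simp [ej]
  have hsum : ‖ei + ej‖ ≤ 2 := (norm_add_le _ _).trans (by rw [hei, hej]; norm_num)
  have key : L ej i + L ei j = ⟪L (ei + ej), ei + ej⟫_ℝ - ⟪L ei, ei⟫_ℝ - ⟪L ej, ej⟫_ℝ := by
    simp only [map_add, inner_add_left, inner_add_right, ei, ej, EuclideanSpace.inner_single_right,
      conj_trivial, one_mul]
    ring
  rw [key]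
  have h1 := hq (ei + ej)
  have h2 := hq ei
  have h3 := hq ej
  rw [hei] at h2
  rw [hej] at h3
  have hs : 0 ≤ s := by nlinarith [abs_nonneg ⟪L ei, ei⟫_ℝ]
  have h1' : |⟪L (ei + ej), ei + ej⟫_ℝ| ≤ s * 4 := by
    refine h1.trans (mul_le_mul_of_nonneg_left ?_ hs)
    nlinarith [norm_nonneg (ei + ej)]
  have := abs_le.1 h1'
  have := abs_le.1 h2
  have := abs_le.1 h3
  rw [abs_le]
  constructor <;> nlinarith


/-- **Korn's cross identity on the torus**: for a smooth divergence-free `W`,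
`∫ ∑ᵢⱼ ∂ⱼWᵢ ∂ᵢWⱼ = 0` (two integrations by parts: `∑ⱼ ∂ⱼ∂ᵢWⱼ = ∂ᵢ div W = 0`). -/
theorem integral_cross_eq_zero {W : (UnitAddTorus (Fin 3)) → (EuclideanSpace ℝ (Fin 3))} (hW : Torus.IsSmooth W) (hdiv : Torus.IsDivFree W) :
    ∫ x, ∑ i, ∑ j, Torus.partialDeriv j W x i * Torus.partialDeriv i W x j = 0 := by
  have hW1 : Torus.IsContDiff 1 W := hW.isContDiff (by simp)
  have hci : ∀ i, Torus.IsSmooth (fun y => W y i) := fun i => hW.apply i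
  have hDs : ∀ i, Torus.IsSmooth (Torus.partialDeriv i W) := fun i => hW.partialDeriv i
  have hDc : ∀ i j, Torus.IsSmooth (fun y => Torus.partialDeriv i W y j) := fun i j => (hDs i).apply j
  -- the product `Wᵢ · (∂ᵢW)ⱼ`
  have hprod : ∀ i j, Torus.IsSmooth (fun y => W y i * Torus.partialDeriv i W y j) :=
    fun i j => (ContDiff.mul (hci i) (hDc i j) : Torus.IsSmooth fun y => W y i * Torus.partialDeriv i W y j)
  -- pointwise: `∂ⱼWᵢ (∂ᵢW)ⱼ = ∂ⱼ(Wᵢ (∂ᵢW)ⱼ) - Wᵢ ∂ⱼ(∂ᵢW)ⱼ`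
  have hpt : ∀ i j x, Torus.partialDeriv j W x i * Torus.partialDeriv i W x j =
      Torus.partialDeriv j (fun y => W y i * Torus.partialDeriv i W y j) x -
        W x i * Torus.partialDeriv j (fun y => Torus.partialDeriv i W y j) x := by
    intro i j x
    rw [Torus.partialDeriv_mul ((hci i).isContDiff (by simp)) ((hDc i j).isContDiff (by simp)),
      Torus.partialDeriv_apply_coord hW1 j x i]
    ring
  -- `∑ⱼ ∂ⱼ (∂ᵢW)ⱼ = ∂ᵢ (div W) = 0`
  have hsum : ∀ i x, ∑ j, Torus.partialDeriv j (fun y => Torus.partialDeriv i W y j) x = 0 := by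
    intro i x
    have h1 : ∀ j, Torus.partialDeriv j (fun y => Torus.partialDeriv i W y j) x =
        Torus.partialDeriv i (Torus.partialDeriv j (fun y => W y j)) x := by
      intro j
      have e : (fun y => Torus.partialDeriv i W y j) = Torus.partialDeriv i (fun y => W y j) := by
        funext y; rw [Torus.partialDeriv_apply_coord hW1]
      rw [e, Torus.partialDeriv_comm (hci j)]
    simp_rw [h1]
    rw [← Torus.partialDeriv_finset_sum Finset.univ
      (fun j _ => ((hci j).partialDeriv j).isContDiff (by simp)) i x]
    have e2 : (fun y => ∑ j ∈ Finset.univ, Torus.partialDeriv j (fun y => W y j) y) = fun _ => (0 : ℝ) := by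
      funext y; exact hdiv y
    rw [e2]
    simp [Torus.partialDeriv, Torus.lineDeriv]
  have hrow : ∀ i x, ∑ j, Torus.partialDeriv j W x i * Torus.partialDeriv i W x j =
      ∑ j, Torus.partialDeriv j (fun y => W y i * Torus.partialDeriv i W y j) x := by
    intro i x
    simp_rw [hpt i]
    rw [Finset.sum_sub_distrib, ← Finset.mul_sum, hsum i x, mul_zero, sub_zero]
  simp_rw [hrow]
  rw [integral_finsetSum _ fun i _ => integrable_finsetSum _ fun j _ => ((hprod i j).partialDeriv j).integrable]
  refine Finset.sum_eq_zero fun i _ => ?_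
  rw [integral_finsetSum _ fun j _ => ((hprod i j).partialDeriv j).integrable]
  exact Finset.sum_eq_zero fun j _ => Torus.integral_partialDeriv_eq_zero_holds (hprod i j) j

/-- Pointwise algebra in dimension three: `∑ᵢⱼ Lᵢⱼ² = ½ ∑ᵢⱼ (Lᵢⱼ + Lⱼᵢ)² − ∑ᵢⱼ Lᵢⱼ Lⱼᵢ`. -/
theorem sum_sq_eq_half_symm_sub_cross (L : Fin 3 → Fin 3 → ℝ) :
    ∑ i, ∑ j, L i j ^ 2 = 2⁻¹ * ∑ i, ∑ j, (L i j + L j i) ^ 2 - ∑ i, ∑ j, L i j * L j i := by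
  simp only [Fin.sum_univ_three]
  ring

/-- The squared Frobenius norm of the velocity gradient: `∑ⱼ ‖∂ⱼW x‖² = ∑ᵢⱼ ((∂ⱼW x) i)²`. -/
theorem sum_norm_sq_partialDeriv_eq (W : (UnitAddTorus (Fin 3)) → (EuclideanSpace ℝ (Fin 3))) (x : (UnitAddTorus (Fin 3))) :
    ∑ j, ‖Torus.partialDeriv j W x‖ ^ 2 = ∑ i, ∑ j, (Torus.partialDeriv j W x i) ^ 2 := by
  rw [Finset.sum_comm]
  refine Finset.sum_congr rfl fun j _ => ?_
  rw [EuclideanSpace.real_norm_sq_eq]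

/-- The matrix entries of the torus derivative: `(∂ⱼW x) i = (DW(x) eⱼ) i`. -/
theorem partialDeriv_apply_eq_fderiv_single {W : (UnitAddTorus (Fin 3)) → (EuclideanSpace ℝ (Fin 3))} (hW : Torus.IsContDiff 1 W) (x : (UnitAddTorus (Fin 3))) (i j : Fin 3) :
    Torus.partialDeriv j W x i = Torus.fderiv W x (EuclideanSpace.single j 1) i := by
  rw [Torus.partialDeriv_eq_fderiv_apply hW]

/-- **Korn-type bound.** For a smooth divergence-free `W` whose strain form is bounded,
`|⟪DW(x) y, y⟫| ≤ s‖y‖²` for all `x, y`, the full gradient is controlled in `L²`: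
`‖∇W‖₂² = ∫ ∑ⱼ ‖∂ⱼW‖² ≤ 162 s²`. -/
theorem gradNormSq_le_of_strain {W : (UnitAddTorus (Fin 3)) → (EuclideanSpace ℝ (Fin 3))} (hW : Torus.IsSmooth W) (hdiv : Torus.IsDivFree W) {s : ℝ}
    (hq : ∀ (x : (UnitAddTorus (Fin 3))) (y : (EuclideanSpace ℝ (Fin 3))), |⟪Torus.fderiv W x y, y⟫_ℝ| ≤ s * ‖y‖ ^ 2) :
    Torus.gradNormSq W ≤ 162 * s ^ 2 := by
  have hW1 : Torus.IsContDiff 1 W := hW.isContDiff (by simp)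
  -- pointwise bound
  have hpt : ∀ x, ∑ j, ‖Torus.partialDeriv j W x‖ ^ 2 ≤
      162 * s ^ 2 - ∑ i, ∑ j, Torus.partialDeriv j W x i * Torus.partialDeriv i W x j := by
    intro x
    rw [sum_norm_sq_partialDeriv_eq, sum_sq_eq_half_symm_sub_cross (fun i j => Torus.partialDeriv j W x i)]
    have hent : ∀ i j, (Torus.partialDeriv j W x i + Torus.partialDeriv i W x j) ^ 2 ≤ (6 * s) ^ 2 := by
      intro i j
      rw [partialDeriv_apply_eq_fderiv_single hW1, partialDeriv_apply_eq_fderiv_single hW1]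
      have h := entry_symm_le (Torus.fderiv W x) (hq x) i j
      exact sq_le_sq' (abs_le.1 h).1 (abs_le.1 h).2
    have hsum : ∑ i, ∑ j, (Torus.partialDeriv j W x i + Torus.partialDeriv i W x j) ^ 2 ≤ 9 * (6 * s) ^ 2 := by
      calc ∑ i, ∑ j, (Torus.partialDeriv j W x i + Torus.partialDeriv i W x j) ^ 2
          ≤ ∑ _i : Fin 3, ∑ _j : Fin 3, (6 * s) ^ 2 :=
            Finset.sum_le_sum fun i _ => Finset.sum_le_sum fun j _ => hent i j
        _ = 9 * (6 * s) ^ 2 := by simp; ring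
    nlinarith
  -- integrate
  have hint1 : Integrable (fun x => ∑ j, ‖Torus.partialDeriv j W x‖ ^ 2) volume :=
    (Torus.isSmooth_sum_norm_sq_partialDeriv hW).integrable
  have hcross : ∀ i j, Torus.IsSmooth (fun x => Torus.partialDeriv j W x i * Torus.partialDeriv i W x j) :=
    fun i j => (ContDiff.mul ((hW.partialDeriv j).apply i) ((hW.partialDeriv i).apply j) :
      Torus.IsSmooth fun x => Torus.partialDeriv j W x i * Torus.partialDeriv i W x j)
  have hint2 : Integrable (fun x => ∑ i, ∑ j, Torus.partialDeriv j W x i * Torus.partialDeriv i W x j) volume :=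
    integrable_finsetSum _ fun i _ => integrable_finsetSum _ fun j _ => (hcross i j).integrable
  have hint3 : Integrable (fun x => 162 * s ^ 2 -
      ∑ i, ∑ j, Torus.partialDeriv j W x i * Torus.partialDeriv i W x j) volume :=
    (integrable_const _).sub hint2
  have hmono := integral_mono hint1 hint3 hpt
  rw [integral_sub (integrable_const _) hint2, integral_cross_eq_zero hW hdiv, sub_zero,
    integral_const] at hmono
  simpa [Torus.gradNormSq] using hmono

/-- The strain form `(x, η) ↦ ⟪η, DW(x) η⟫` of a smooth field is jointly continuous. -/
theorem continuous_strainForm {W : (UnitAddTorus (Fin 3)) → (EuclideanSpace ℝ (Fin 3))} (hW : Torus.IsSmooth W) :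
    Continuous fun p : (UnitAddTorus (Fin 3)) × (EuclideanSpace ℝ (Fin 3)) => ⟪p.2, Torus.fderiv W p.1 p.2⟫_ℝ := by
  have hW1 : Torus.IsContDiff 1 W := hW.isContDiff (by simp)
  have h : (fun p : (UnitAddTorus (Fin 3)) × (EuclideanSpace ℝ (Fin 3)) => Torus.fderiv W p.1 p.2) =
      fun p => ∑ j, p.2 j • Torus.partialDeriv j W p.1 := by
    funext p; exact Torus.fderiv_apply_eq_sum_partialDeriv hW1 p.1 p.2
  refine continuous_snd.inner ?_
  rw [h]
  refine continuous_finsetSum _ fun j _ => ?_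
  exact ((EuclideanSpace.proj (𝕜 := ℝ) j).continuous.comp continuous_snd).smul
    ((hW.partialDeriv j).continuous.comp continuous_fst)

/-- The trace of the torus derivative of a smooth divergence-free field vanishes; along any orthonormal
basis `b`: `∑ᵢ ⟪b i, DW(x) (b i)⟫ = 0`. -/
theorem sum_strainForm_orthonormalBasis_eq_zero {W : (UnitAddTorus (Fin 3)) → (EuclideanSpace ℝ (Fin 3))} (hW : Torus.IsSmooth W) (hdiv : Torus.IsDivFree W)
    {ι : Type*} [Fintype ι] (b : OrthonormalBasis ι ℝ (EuclideanSpace ℝ (Fin 3))) (x : (UnitAddTorus (Fin 3))) :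
    ∑ i, ⟪b i, Torus.fderiv W x (b i)⟫_ℝ = 0 := by
  have hW1 : Torus.IsContDiff 1 W := hW.isContDiff (by simp)
  have h := Torus.divergence_eq_trace_fderiv hW1 x
  rw [hdiv x, LinearMap.trace_eq_sum_inner _ b] at h
  exact h.symm

/-- **The strain supremum and the most compressive direction.** For a smooth divergence-free `W`
there is `s ≥ 0` bounding the strain form on unit vectors, `|⟪η, DW(x) η⟫| ≤ s`, together with a point
`x₀` and a unit direction `ξ` where the strain form is at most `−s/2` (the symmetric gradient is
trace-free: if the extremal value `s` is attained with the positive sign at `(x₁, η₁)`, the two directions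
completing `η₁` to an orthonormal basis carry strain summing to `−s`). -/
theorem exists_strain_sup {W : (UnitAddTorus (Fin 3)) → (EuclideanSpace ℝ (Fin 3))} (hW : Torus.IsSmooth W) (hdiv : Torus.IsDivFree W) :
    ∃ s : ℝ, 0 ≤ s ∧ (∀ (x : (UnitAddTorus (Fin 3))) (η : (EuclideanSpace ℝ (Fin 3))), ‖η‖ = 1 → |⟪η, Torus.fderiv W x η⟫_ℝ| ≤ s) ∧
      ∃ (x₀ : (UnitAddTorus (Fin 3))) (ξ : (EuclideanSpace ℝ (Fin 3))), ‖ξ‖ = 1 ∧ ⟪ξ, Torus.fderiv W x₀ ξ⟫_ℝ ≤ -(s / 2) := by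
  set q : (UnitAddTorus (Fin 3)) × (EuclideanSpace ℝ (Fin 3)) → ℝ := fun p => ⟪p.2, Torus.fderiv W p.1 p.2⟫_ℝ with hq
  have hqc : Continuous q := continuous_strainForm hW
  set K : Set ((UnitAddTorus (Fin 3)) × (EuclideanSpace ℝ (Fin 3))) := (Set.univ : Set (UnitAddTorus (Fin 3))) ×ˢ Metric.sphere (0 : (EuclideanSpace ℝ (Fin 3))) 1 with hK
  have hKc : IsCompact K := isCompact_univ.prod (isCompact_sphere _ _)
  have hKne : K.Nonempty := ⟨(0, EuclideanSpace.single 0 1), Set.mem_univ _, by simp⟩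
  obtain ⟨p₁, hp₁K, hmax⟩ := hKc.exists_isMaxOn hKne (continuous_abs.comp hqc).continuousOn
  have hp₁ : ‖p₁.2‖ = 1 := by simpa [hK] using hp₁K
  set s : ℝ := |q p₁| with hs
  have hbound : ∀ (x : (UnitAddTorus (Fin 3))) (η : (EuclideanSpace ℝ (Fin 3))), ‖η‖ = 1 → |q (x, η)| ≤ s := by
    intro x η hη
    have hmem : (x, η) ∈ K := ⟨Set.mem_univ _, by simpa using hη⟩
    exact hmax hmem
  refine ⟨s, abs_nonneg _, fun x η hη => hbound x η hη, ?_⟩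
  by_cases hsign : q p₁ ≤ 0
  · refine ⟨p₁.1, p₁.2, hp₁, ?_⟩
    have : s = -q p₁ := abs_of_nonpos hsign
    change q (p₁.1, p₁.2) ≤ -(s / 2)
    rw [Prod.mk.eta, this]
    linarith [abs_nonneg (q p₁)]
  · push Not at hsign
    have hs' : s = q p₁ := abs_of_pos hsign
    -- complete `η₁ = p₁.2` to an orthonormal basis
    have hon : Orthonormal ℝ (Subtype.val : (({p₁.2} : Set (EuclideanSpace ℝ (Fin 3)))) → (EuclideanSpace ℝ (Fin 3))) := by
      rw [orthonormal_iff_ite]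
      rintro ⟨i, hi⟩ ⟨j, hj⟩
      rw [Set.mem_singleton_iff] at hi hj
      subst hi; subst hj
      simp [hp₁]
    obtain ⟨u, b, hu, hb⟩ := hon.exists_orthonormalBasis_extension
    have hmem : p₁.2 ∈ u := by
      have := hu (Set.mem_singleton p₁.2)
      simpa using this
    have hcard : Fintype.card u = 3 := by
      have h1 := Module.finrank_eq_card_basis b.toBasis
      rw [finrank_euclideanSpace_fin] at h1
      exact h1.symm
    have htr := sum_strainForm_orthonormalBasis_eq_zero hW hdiv b p₁.1
    by_contra hcon
    push Not at hcon
    -- every basis direction has strain `> -s/2`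
    have hgt : ∀ i : u, -(s / 2) < q (p₁.1, b i) := by
      intro i
      have hn : ‖b i‖ = 1 := b.orthonormal.1 i
      exact hcon p₁.1 (b i) hn
    set i₀ : u := ⟨p₁.2, hmem⟩ with hi₀
    have hbi₀ : b i₀ = p₁.2 := by rw [hb]
    have hq₀ : q (p₁.1, b i₀) = s := by rw [hbi₀, Prod.mk.eta, hs']
    have hsplit := Finset.add_sum_erase Finset.univ (fun i : u => q (p₁.1, b i)) (Finset.mem_univ i₀)
    have hcard' : (Finset.univ.erase i₀ : Finset u).card = 2 := by
      rw [Finset.card_erase_of_mem (Finset.mem_univ _), Finset.card_univ, hcard]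
    have hne : (Finset.univ.erase i₀ : Finset u).Nonempty := by
      rw [← Finset.card_pos, hcard']; norm_num
    have hlt : ∑ _i ∈ Finset.univ.erase i₀, (-(s / 2)) < ∑ i ∈ Finset.univ.erase i₀, q (p₁.1, b i) :=
      Finset.sum_lt_sum_of_nonempty hne fun i _ => hgt i
    rw [Finset.sum_const, hcard', nsmul_eq_mul] at hlt
    have htot : ∑ i, q (p₁.1, b i) = 0 := htr
    rw [← hsplit, hq₀] at htot
    push_cast at hlt
    linarith

end Summit.AnomalousDissipation.AnomalousDissipation.Theorems.PhantomFloor
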